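import Summits.QuantumFields.YangMills.Theorems.AlphaInputsT3ACv2RecHistories
import HarnessLib

/-!
# `AlphaInputsT3ACv2RecZterm` — THE SIZE OF THE LARGE-FIELD TERM `Zterm` OF THE v2 DATUM (line v5p4 of crux `HistoryTailL` =
# stmt-QuantumFields-19936, STUB 2″ `stub_alphaOfLaneFull` clause (d)) and the measurability of its interaction sum at every level (STUB 2‴
# clause (e″)) — both UNCONDITIONAL given the package, from the lane's DEFINITIONS

Lane `pub-balaban3d`, seat alpha-1 (g3).  (d) For the concrete datum `OfV2At.dataT3c`, `Zterm^{(K)}_j(h) = Σ_{i<j} zcoef_i·|Z_i(h)|` with the lane's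
BOOKED coefficient `zcoefOf i = (C_z + C_v)g_i + C₅ + C₆ + 3(|log σ₀| + d(𝔤)·log g_i⁻¹)` (`Carriers.Standard.zcoefOf`, `c₁ = 3`) and
`|Z_i(h)| = Carriers.ZVol … j h i` = the number of level-`i` sites whose block meets `Ω_{i+1}(h)ᶜ`.  Since `0 < g_i ≤ 1` for `i ≤ K` and `Ω_{i+1}(h)` is
a union of big blocks of scale `i + 1` (`Carriers.Omega_bigBlock`), this gives `0 ≤ Zterm_j(h) ≤ A·Σ_{i<j} (1 + log g_i⁻¹)·#{y : toFine y ∉ Ω_{i+1}(h)}`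
with `A = 𝔠.Alf = (C_z + C_v) + C₅ + C₆ + 3(|log σ₀| + d(𝔤))` — the text of clause (d) with `κZ := 𝔠.Alf` (fixed with the record, before the family).
(e″) `Pint^{(K)}_j(h, ·)` is measurable for every `j ≤ K` and every history: the step row `hPm` below the top, the terminal row at the top.
[folklore] bookkeeping on the lane's definitions, CONDITIONAL on the package only through the data it names; nothing of [Balaban1985UV3] asserted.

References: T. Bałaban, Commun. Math. Phys. 102 (1985) 255–275 [Balaban1985UV3] ((38)–(41) p.266, (43) p.266).
-/

set_option autoImplicit false

noncomputable section

namespace Summit.QuantumFields.YangMills.Theorems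

open MeasureTheory
open Literature.MathematicalPhysics.QuantumFieldTheory.Balaban1983to89
open Literature.MathematicalPhysics.QuantumFieldTheory.Balaban1983to89.T3ContinuumYM3Torus
open Literature.MathematicalPhysics.QuantumFieldTheory.Balaban1983to89.T3AlphaInputsAC
open Literature.MathematicalPhysics.QuantumFieldTheory.Balaban1983to89.B10Eq38TorusDomains (toFine)
open Literature.MathematicalPhysics.QuantumFieldTheory.Balaban1985CMP102
open Literature.MathematicalPhysics.QuantumFieldTheory.Balaban1985CMP102.Setting
open Summit.QuantumFields.Balaban3D.Carriers
open Summit.QuantumFields.Balaban3D.Proofs.Primitives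
open Summit.QuantumFields.Balaban3D.Proofs.ScalesArithmetic (gk_pos gk_le_one)
open Summit.QuantumFields.Balaban3D.Proofs.TowerAC
open Summit.QuantumFields.Balaban3D.Proofs.StandardAC
open Summit.QuantumFields.Balaban3D.Proofs.InputsAC

/-! ## §1 The booked `Z`-coefficient is `≤ A·(1 + log g⁻¹)` -/

section Coef

variable {L : ℕ} (𝔠 : AlphaConsts L (suGroupModel 2).N) (S : Scales L)

/-- `A = 𝔠.Alf ≥ 0` (dot-notation extension of the lane's `Primitives.AlphaConsts`, declared with its absolute name). [folklore] -/
theorem _root_.Summit.QuantumFields.Balaban3D.Proofs.Primitives.AlphaConsts.Alf_nonneg : 0 ≤ 𝔠.Alf := by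
  unfold AlphaConsts.Alf
  have h1 := 𝔠.Cz_nonneg; have h2 := 𝔠.Cv_nonneg; have h3 := 𝔠.C₅_nonneg; have h4 := 𝔠.C₆_nonneg
  have h5 : 0 ≤ |𝔠.logσ₀| := abs_nonneg _
  have h6 : (0 : ℝ) ≤ (𝔠.dimg : ℝ) := Nat.cast_nonneg _
  nlinarith

/-- **THE BOOKED COEFFICIENT OF `|Z_i|` IS NON-NEGATIVE AND `≤ A·(1 + log g_i⁻¹)`** for `0 < g_i ≤ 1`:
`zcoefOf i = (C_z + C_v)g_i + C₅ + C₆ + 3(|log σ₀| + d(𝔤) log g_i⁻¹)` (`Carriers.Standard.zcoefOf` at the record's carrier constants, `c₁ = 3`).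
[cite: Balaban1985UV3, (41) p.266] -/
theorem _root_.Summit.QuantumFields.Balaban3D.Proofs.Primitives.AlphaConsts.zcoefOf_nonneg_le (i : ℕ) (hi : i ≤ S.K) :
    0 ≤ zcoefOf S 𝔠.lane.carrier i ∧ zcoefOf S 𝔠.lane.carrier i ≤ 𝔠.Alf * (1 + Real.log (S.gk i)⁻¹) := by
  have hg := gk_pos S i
  have hg1 := gk_le_one S S.gK_le_one i hi
  have hlog : 0 ≤ Real.log (S.gk i)⁻¹ := Real.log_nonneg (one_le_inv_iff₀.mpr ⟨hg, hg1⟩)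
  have h1 := 𝔠.Cz_nonneg; have h2 := 𝔠.Cv_nonneg; have h3 := 𝔠.C₅_nonneg; have h4 := 𝔠.C₆_nonneg
  have h5 : 0 ≤ |𝔠.logσ₀| := abs_nonneg _
  have h6 : (0 : ℝ) ≤ (𝔠.dimg : ℝ) := Nat.cast_nonneg _
  show 0 ≤ (𝔠.Cz + 𝔠.Cv) * S.gk i + 𝔠.C₅ + 𝔠.C₆ + (|𝔠.logσ₀| + (𝔠.dimg : ℝ) * Real.log (S.gk i)⁻¹) * 3 ∧
    (𝔠.Cz + 𝔠.Cv) * S.gk i + 𝔠.C₅ + 𝔠.C₆ + (|𝔠.logσ₀| + (𝔠.dimg : ℝ) * Real.log (S.gk i)⁻¹) * 3 ≤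
      ((𝔠.Cz + 𝔠.Cv) + 𝔠.C₅ + 𝔠.C₆ + (|𝔠.logσ₀| + (𝔠.dimg : ℝ)) * 3) * (1 + Real.log (S.gk i)⁻¹)
  constructor
  · nlinarith
  · nlinarith [mul_nonneg (add_nonneg h1 h2) hlog, mul_nonneg h3 hlog, mul_nonneg h4 hlog, mul_nonneg h5 hlog]

end Coef

/-! ## §2 The large-field volume `|Z_i(h)|` counts the level-`i` sites whose fine representative is outside `Ω_{i+1}(h)` -/

section Volume

variable {P : Params} (M₁ : ℕ) (Rcol : ℕ → ℕ)

open Classical in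
/-- **`|Z_i(h)| = #{y ∈ T^{(i)} : toFine y ∉ Ω_{i+1}(h)}`** for `i < j` (`h` a `j`-step history) in the standing range: the lane's `ZVol` counts the
level-`i` sites whose scale-`i` block MEETS `Ω_{i+1}(h)ᶜ`; as `Ω_{i+1}(h)` is a union of big blocks of scale `i + 1` (`Carriers.Omega_bigBlock`),
«meets» = «the representative fine site `toFine i y` is outside». [cite: Balaban1985UV3, (38)–(39) p.266] -/
theorem ZVol_eq_ncard (j : ℕ) (h : Hist P j) (i : ℕ) (hij : i < j) (hi : i ≤ P.m + P.K) :
    (ZVol M₁ Rcol j h i : ℝ) = (({y : Site P i | toFine i y ∉ Omega M₁ Rcol j h (i + 1)} : Set (Site P i)).ncard : ℝ) := by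
  have hset : ({y : Site P i | toFine i y ∉ Omega M₁ Rcol j h (i + 1)} : Set (Site P i)) =
      ↑(Finset.univ.filter fun z : Site P i => ∃ x : Site P 0, coarsen i x = z ∧ x ∈ Zreg M₁ Rcol h i) := by
    ext y
    simp only [Set.mem_setOf_eq, Finset.coe_filter, Finset.mem_univ, true_and, Zreg, Set.mem_compl_iff]
    constructor
    · intro hy
      exact ⟨toFine i y, coarsen_toFine i hi y, hy⟩
    · rintro ⟨x, hx, hxO⟩ hyO
      apply hxO
      have hbb : bigBlockOf M₁ (i + 1) x = bigBlockOf M₁ (i + 1) (toFine i y) := by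
        unfold bigBlockOf
        rw [coarsen_succ, coarsen_succ, hx, coarsen_toFine i hi y]
      exact (Omega_bigBlock M₁ Rcol j h (i + 1) (by omega) (by omega) x (toFine i y) hbb).mpr hyO
  rw [hset, Set.ncard_coe_finset]
  rfl

end Volume

/-! ## §3 Clause (d) of STUB 2″ and clause (e″) of STUB 2‴ for the v2 datum -/

section Datum

variable {F : T3Family} {𝔠 : AlphaConsts F.L (suGroupModel 2).N} {a₀ a₁ : ℝ}
  (h : AlphaInputsT3AC.OfV2At F 𝔠 a₀ a₁) (hc : 0 < a₀ ∧ 0 < a₁ ∧ 𝔠.B₃ * a₁ ≤ a₀) (γ : ℝ) (hγ : 0 < γ)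
  (hγ1 : γ ≤ (min 𝔠.gamma0 1) ^ 2) (π : AlphaInputsT3AC.PolymerT3 F)

/-- The datum's large-field term unfolded: `Zterm^{(K)}_j(h) = Σ_{i<j} zcoefOf i · |Z_i(h)|` (definitional). [cite: Balaban1985UV3, (41) p.266] -/
theorem AlphaInputsT3AC.OfV2At.dataT3c_Zterm_eq (K j : ℕ) (r : Hist (F.P K) j) :
    (h.dataT3c hc γ hγ hγ1 π).Zterm K j r =
      ∑ i ∈ Finset.range j, zcoefOf (T3Scales F γ hγ (hγ1.trans (sq_min_one_le _ 𝔠.gamma0_pos)) K) 𝔠.lane.carrier i *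
        (ZVol 𝔠.lane.carrier.M₁ (rcolOf (T3Scales F γ hγ (hγ1.trans (sq_min_one_le _ 𝔠.gamma0_pos)) K) 𝔠.lane.carrier) j r i : ℝ) := rfl

/-- **STUB 2″ CLAUSE (d) — THE SIZE OF THE LARGE-FIELD TERM, PROVED with `κZ := 𝔠.Alf`**: for the concrete datum, every run `K`, level
`j ≤ K`, region history `r` and fibre variable `v`,
`0 ≤ Zterm_j(h) ≤ A·Σ_{i<j} (1 + log(√(γL^{−(K−i)}))⁻¹)·#{y ∈ T^{(i)} : toFine y ∉ Ω_{i+1}(h)}` with `h = assemble r v = r`,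
`A = (C_z + C_v) + C₅ + C₆ + 3(|log σ₀| + d(𝔤))` — the printed «Σ_{j<k} O(log g_j⁻¹)|Z_j|» of (41) p.266 with the lane's booked coefficient and the volume read on
the unit lattice of each level. [cite: Balaban1985UV3, (41) p.266] -/
theorem AlphaInputsT3AC.OfV2At.dataT3c_ztermSize (K j : ℕ) (r : (h.lfDataT3c hc γ hγ hγ1 π).Reg K j)
    (v : (i : Fin j) → GaugeField (F.P K) i (Matrix.specialUnitaryGroup (Fin 2) ℂ)) (hj : j ≤ K) :
    0 ≤ (h.dataT3c hc γ hγ hγ1 π).Zterm K j ((h.lfDataT3c hc γ hγ hγ1 π).assemble K j r v) ∧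
    (h.dataT3c hc γ hγ hγ1 π).Zterm K j ((h.lfDataT3c hc γ hγ hγ1 π).assemble K j r v) ≤
      𝔠.Alf * ∑ i ∈ Finset.range j,
        (1 + Real.log (Real.sqrt (γ * ((F.L : ℝ)⁻¹) ^ (K - i)))⁻¹) *
          (({y : Site (F.P K) i | toFine i y ∉ (h.dataT3c hc γ hγ hγ1 π).Ω K j
              ((h.lfDataT3c hc γ hγ hγ1 π).assemble K j r v) (i + 1)} : Set (Site (F.P K) i)).ncard : ℝ) := by
  have hγ1' : γ ≤ 1 := hγ1.trans (sq_min_one_le _ 𝔠.gamma0_pos)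
  rw [h.lfDataT3c_assemble_eq hc γ hγ hγ1 π, h.dataT3c_Zterm_eq hc γ hγ hγ1 π, Finset.mul_sum]
  refine ⟨Finset.sum_nonneg fun i hi => ?_, Finset.sum_le_sum fun i hi => ?_⟩
  · have hiK : i ≤ K := (Finset.mem_range.mp hi).le.trans hj
    exact mul_nonneg (𝔠.zcoefOf_nonneg_le (T3Scales F γ hγ hγ1' K) i hiK).1 (Nat.cast_nonneg _)
  · have hij : i < j := Finset.mem_range.mp hi
    have hiK : i ≤ K := hij.le.trans hj
    have hz := (𝔠.zcoefOf_nonneg_le (T3Scales F γ hγ hγ1' K) i hiK).2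
    rw [T3Scales_gk_eq F γ hγ hγ1' K i hiK] at hz
    have hvol : (ZVol 𝔠.lane.carrier.M₁ (rcolOf (T3Scales F γ hγ hγ1' K) 𝔠.lane.carrier) j r i : ℝ) =
        (({y : Site (F.P K) i | toFine i y ∉ (h.dataT3c hc γ hγ hγ1 π).Ω K j r (i + 1)} : Set (Site (F.P K) i)).ncard : ℝ) :=
      ZVol_eq_ncard _ _ j r i hij (by show i ≤ F.m + K; omega)
    rw [hvol, ← mul_assoc]
    exact mul_le_mul_of_nonneg_right hz (Nat.cast_nonneg _)

/-- **STUB 2‴ CLAUSE (e″) — `Pint^{(K)}_j(h, ·)` IS MEASURABLE, every `j ≤ K`, every history**: the step row `hPm` of `StepAlphaAC` for `j < K`,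
the terminal row `TerminalRowsT3` at `j = K`. [cite: Balaban1985UV3, (43) p.266] -/
theorem AlphaInputsT3AC.OfV2At.dataT3c_measurable_Pint (K j : ℕ) (hj : j ≤ K) (r : Hist (F.P K) j) :
    Measurable fun W : GaugeField (F.P K) j (Matrix.specialUnitaryGroup (Fin 2) ℂ) => (h.dataT3c hc γ hγ hγ1 π).Pint K j r W := by
  rcases Nat.lt_or_eq_of_le hj with hlt | heq
  · exact ((h.pkgAtV2 hc γ hγ hγ1 K).run.steps j hlt).hPm r
  · subst heq
    exact (h.pkgAtV2 hc γ hγ hγ1 j).terminal_measurable_Pint r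

end Datum

end Summit.QuantumFields.YangMills.Theorems

end
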